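import Literature.NumberTheory.Sieve.PolynomialCongruences
import HarnessLib

/-!
# Route `RoughValueTransport`, crux `BalancedSemiprimeLayer` (stmt-Parity-9469):
# vocabulary of the line `smooth-modulus-twisted-hooley`

Route-posited objects (D-0016 `<Route>Defs` file) shared by the registered stubs of the skeleton
`Cruxes/BalancedSemiprimeLayer/Lines/smooth-modulus-twisted-hooley.lean` and by the crux file that
composes them.  Everything here is a plain `Finset.filter` count or a `Prop` over existing tree
declarations (`Literature.NumberTheory.Sieve.polyRootWeylSum`, `polyRootCountMod`,
`Polynomial.eval`, `discrim`); nothing is asserted.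

* `coordLayer f i δ x = E_{f,i}(x, δ)` — the `1 ≤ n ≤ x` that are JOINTLY rough to the crux's depth
  (every `fⱼ(n) > 0` and free of primes `< x^{deg fⱼ (1−δ)/2}`, verbatim the crux's predicate) but
  whose `i`-th value `fᵢ(n)` is not prime; `CoordLayerThin f i` — "for every `ε > 0` some
  `δ ∈ (0, 1/4]` makes `E_{f,i}(x, δ) ≤ ε·x/(log x)^k` eventually";
* `TwistedHooleyDilates D` — the line's lever: a Hooley-1963-type power saving for the root Weyl
  sums of the dilates `Q²X² − D` over moduli `m ≤ M` in a class `m ≡ u (mod Q)`, `(m, Q) = 1`,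
  losses polynomial in `Q`, `h`;
* `UniformTypeI g` — plain Type-I information for the congruence counts of a quadratic `g` in
  progressions `t ≡ b₀ (mod q)`, level `ℓ`, moduli up to `y^{1+θ}`, uniformly in `q ≤ y^θ`;
* `quadWindow δ x = ℕ ∩ [x^{1−δ}, x^{1+δ}]` — the balanced-divisor window of a quadratic
  coordinate; `pairFamily f i δ c x` — the relaxed, sifted divisor family
  `{(n, m) : 1 ≤ n ≤ x, m ∈ quadWindow δ x, m ∣ fᵢ(n), (m, B_{fᵢ}) = 1, every fⱼ(n) > 0 and
  x^c-rough}` (`B_g = |2a·disc g|`) into which the quadratic layer injects (both balanced primes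
  relaxed — legal because the crux is an UPPER bound) and which the `(k+1)`-dimensional sieve
  bounds;
* small API: `stub_coordLayerMono` / `coordLayer_mono` (monotone in `δ`; the former is the skeleton's
  registered bookkeeping stub, verbatim, through which this file lands `--supports stmt-Parity-9469`),
  `mem_pairFamily`.

References: the line card `Cruxes/BalancedSemiprimeLayer/Lines/smooth-modulus-twisted-hooley.md`;
C. Hooley, Acta Math. 110 (1963) Thm 1 (the `Q = 1` rung, PROVED in the tree as
`hooley1963_quadraticRoots_allModuli_logSqSaving_holds`); W. Duke, J. Friedlander, H. Iwaniec,
Ann. of Math. 141 (1995) §2.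
-/

noncomputable section

open Polynomial Filter Finset
open Literature.NumberTheory.Sieve
open scoped BigOperators

namespace Summit.Parity.BatemanHorn.Cruxes.BalancedSemiprimeLayer.SmoothModulusTwistedHooley

/-! ### The coordinate layer -/

/-- `E_{f,i}(x, δ)`: the `1 ≤ n ≤ x` that are JOINTLY rough to the crux's depth (every `fⱼ(n) > 0` and
free of primes `< x^{deg fⱼ (1−δ)/2}` — verbatim the crux's predicate) but whose `i`-th value `fᵢ(n)`
is NOT prime.  For `δ < 1/3` these are the `n` with a balanced semiprime (or unit) value in coordinate
`i`; the crux's excess `Φ_f − P_f` is at most `∑ᵢ E_{f,i}`.  The other coordinates are kept rough on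
purpose (`Negative.not_cruxCoordinatewise`). [folklore] -/
def coordLayer {k : ℕ} (f : Fin k → ℤ[X]) (i : Fin k) (δ : ℝ) (x : ℕ) : ℕ :=
  #((Icc 1 x).filter (fun n : ℕ => (∀ j, 0 < (f j).eval (n : ℤ) ∧
      ∀ p ∈ range ⌈(x : ℝ) ^ (((f j).natDegree : ℝ) * (1 - δ) / 2)⌉₊,
        p.Prime → ¬ ((p : ℤ) ∣ (f j).eval (n : ℤ))) ∧ ¬ ((f i).eval (n : ℤ)).toNat.Prime))

/-- "The layer of coordinate `i` of the system `f` is thin": for every `ε > 0` some `δ ∈ (0, 1/4]`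
makes `E_{f,i}(x, δ) ≤ ε·x/(log x)^k` eventually (`k` = size of the system: the spectator
coordinates supply the other logarithms). [folklore] -/
def CoordLayerThin {k : ℕ} (f : Fin k → ℤ[X]) (i : Fin k) : Prop :=
  ∀ ε : ℝ, 0 < ε → ∃ δ : ℝ, 0 < δ ∧ δ ≤ 1 / 4 ∧ ∀ᶠ x : ℕ in atTop,
    (coordLayer f i δ x : ℝ) ≤ ε * (x : ℝ) / Real.log x ^ k

/-- **stub_coordLayerMono** (the registered bookkeeping stub of the skeleton
`Cruxes/BalancedSemiprimeLayer/Lines/smooth-modulus-twisted-hooley.lean`, through which this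
vocabulary file lands as a `--supports` file).  `E_{f,i}(x, δ)` is monotone in `δ`: a smaller `δ`
sifts further (`x^{d(1−δ₁)/2} ≥ x^{d(1−δ₂)/2}` for `δ₁ ≤ δ₂`, `x ≥ 1`).  Used by the composition
(`δ := minᵢ δᵢ`). [folklore] -/
theorem stub_coordLayerMono :
    ∀ (k : ℕ) (f : Fin k → ℤ[X]) (i : Fin k) (δ₁ δ₂ : ℝ), δ₁ ≤ δ₂ →
      ∀ x : ℕ, coordLayer f i δ₁ x ≤ coordLayer f i δ₂ x := by
  intro k f i δ₁ δ₂ h x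
  unfold coordLayer
  refine card_le_card fun n hn => ?_
  simp only [mem_filter, mem_Icc] at hn ⊢
  refine ⟨hn.1, fun j => ⟨(hn.2.1 j).1, fun p hp hpp => (hn.2.1 j).2 p ?_ hpp⟩, hn.2.2⟩
  rw [mem_range] at hp ⊢
  refine lt_of_lt_of_le hp (Nat.ceil_mono ?_)
  have hx : (1 : ℝ) ≤ x := by exact_mod_cast hn.1.1.trans hn.1.2
  refine Real.rpow_le_rpow_of_exponent_le hx ?_
  have hd : (0 : ℝ) ≤ (f j).natDegree := Nat.cast_nonneg _
  nlinarith

/-- `E_{f,i}(x, δ)` is monotone in `δ` (curried form of `stub_coordLayerMono`). [folklore] -/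
theorem coordLayer_mono {k : ℕ} (f : Fin k → ℤ[X]) (i : Fin k) {δ₁ δ₂ : ℝ} (h : δ₁ ≤ δ₂)
    (x : ℕ) : coordLayer f i δ₁ x ≤ coordLayer f i δ₂ x :=
  stub_coordLayerMono k f i δ₁ δ₂ h x

/-! ### The lever and the Type-I interface -/

/-- **The lever** (card `smooth-modulus-twisted-hooley`, First lemma): Hooley-1963-type POWER saving
for the root Weyl sums `S_{Q²X²−D}(h; m) = ∑_{ν mod m, Q²ν² ≡ D} e(hν/m)` of the dilates of `X² − D`
over moduli `m ≤ M` in a fixed class `m ≡ u (mod Q)`, `(m, Q) = 1`, with losses polynomial in `Q`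
and `h`.  For `(m, Q) = 1`, `S_{Q²X²−D}(h; m) = S_{X²−D}(h Q̄; m)`: the `Q̄`-twisted Hooley sum.
`Q = 1`: the PROVED `hooley1963_quadraticRoots_allModuli_logSqSaving_holds` (`η = 1/4 − o(1)`). [folklore] -/
def TwistedHooleyDilates (D : ℤ) : Prop :=
  ∃ η : ℝ, 0 < η ∧ ∃ A K : ℝ, ∀ (Q u : ℕ) (h : ℤ) (M : ℕ), 0 < Q → h ≠ 0 → 2 ≤ M →
    ‖∑ m ∈ (Icc 1 M).filter (fun m : ℕ => m ≡ u [MOD Q] ∧ m.Coprime Q),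
        polyRootWeylSum (C ((Q : ℤ) ^ 2) * X ^ 2 - C D) m h‖ ≤
      K * (Q : ℝ) ^ A * |(h : ℝ)| ^ A * (M : ℝ) ^ (1 - η)

/-- **Uniform plain Type-I information for the congruence counts of a quadratic `g`** (the shape
consumed by the cofactor sieve; compare the conclusion of the PROVED
`TypeIFromWeyl.typeI_of_weylLevelBound`, which is this statement for ONE fixed `q`): for `y ≥ y₀`,
every progression modulus `1 ≤ q ≤ y^θ`, class `b₀`, level `1 ≤ ℓ ≤ y^θ` and moduli range
`N₁ < n ≤ N₂ ≤ y^{1+θ}` (BEYOND the length `y` of the `t`-range),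
`|∑_{N₁<n≤N₂, ℓ∣n, (n, q·B_g)=1} (#{y<t≤2y : t ≡ b₀ (q), n ∣ g(t)} − (y/q)·ρ_g(n)/n)| ≤ K·y^{1−ε₀}`
with `K, y₀, θ, ε₀` depending on `g` only; `B_g = |2·a·Δ|` is the bad modulus of `g = aX²+bX+c`,
`Δ = b² − 4ac`. [folklore] -/
def UniformTypeI (g : ℤ[X]) : Prop :=
  ∃ θ ε₀ K : ℝ, 0 < θ ∧ 0 < ε₀ ∧ ∃ y₀ : ℕ, ∀ y : ℕ, y₀ ≤ y →
    ∀ q b₀ : ℕ, 1 ≤ q → (q : ℝ) ≤ (y : ℝ) ^ θ →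
    ∀ ℓ N₁ N₂ : ℕ, 1 ≤ ℓ → (ℓ : ℝ) ≤ (y : ℝ) ^ θ → N₁ ≤ N₂ → (N₂ : ℝ) ≤ (y : ℝ) ^ (1 + θ) →
      |∑ n ∈ (Ioc N₁ N₂).filter (fun n : ℕ => ℓ ∣ n ∧
          n.Coprime (q * (2 * g.coeff 2 * discrim (g.coeff 2) (g.coeff 1) (g.coeff 0)).natAbs)),
        ((#((Ioc y (2 * y)).filter (fun t : ℕ => t % q = b₀ % q ∧ (n : ℤ) ∣ g.eval (t : ℤ))) : ℝ) -
          (y : ℝ) / q * (polyRootCountMod ![g] n : ℝ) / n)| ≤ K * (y : ℝ) ^ (1 - ε₀)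

/-! ### The relaxed divisor family of a quadratic coordinate -/

/-- The **balanced-divisor window** of a quadratic coordinate at height `x`:
`quadWindow δ x = ℕ ∩ [x^{1−δ}, x^{1+δ}]`, of logarithmic length `2δ·log x` — the smaller prime
factor `p₁` of a balanced semiprime value `fᵢ(n) = p₁p₂` (`deg fᵢ = 2`, `n ≤ x`, `p₁ ≥ x^{1−δ}`) lies
in it eventually (`p₁² ≤ fᵢ(n) ≪ x²`). [folklore] -/
def quadWindow (δ : ℝ) (x : ℕ) : Finset ℕ :=
  Icc ⌈(x : ℝ) ^ (1 - δ)⌉₊ ⌊(x : ℝ) ^ (1 + δ)⌋₊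

/-- The **relaxed, sifted divisor family** of the quadratic coordinate `g = fᵢ` at height `x`:
pairs `(n, m)` with `1 ≤ n ≤ x`, `m ∈ quadWindow δ x`, `m ∣ g(n)`, `(m, B_g) = 1`
(`B_g = |2a·disc g|`, the bad modulus of `UniformTypeI`), every `fⱼ(n) > 0` and free of primes
`< x^c`.  BOTH balanced primes are relaxed (`p₁ ↦ m`, the cofactor's primality dropped): the layer
of coordinate `i` injects into it (`n ↦ (n, minFac fᵢ(n))`), and it is ONE sieve problem of
dimension `k + 1` (the pairs `{m ∣ g(n)}` sifted by `p ∣ m·∏ⱼ fⱼ(n)`; `m` is automatically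
`x^c`-rough since `m ∣ g(n)`). [folklore] -/
def pairFamily {k : ℕ} (f : Fin k → ℤ[X]) (i : Fin k) (δ c : ℝ) (x : ℕ) : Finset (ℕ × ℕ) :=
  (Icc 1 x ×ˢ quadWindow δ x).filter (fun nm : ℕ × ℕ =>
    (∀ j, 0 < (f j).eval (nm.1 : ℤ) ∧
      ∀ p ∈ range ⌈(x : ℝ) ^ c⌉₊, p.Prime → ¬ ((p : ℤ) ∣ (f j).eval (nm.1 : ℤ))) ∧
    ((nm.2 : ℤ) ∣ (f i).eval (nm.1 : ℤ)) ∧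
    nm.2.Coprime
      (2 * (f i).coeff 2 * discrim ((f i).coeff 2) ((f i).coeff 1) ((f i).coeff 0)).natAbs)

/-- Membership in `pairFamily` (unfolding). [folklore] -/
theorem mem_pairFamily {k : ℕ} (f : Fin k → ℤ[X]) (i : Fin k) (δ c : ℝ) (x : ℕ) (nm : ℕ × ℕ) :
    nm ∈ pairFamily f i δ c x ↔
      (nm.1 ∈ Icc 1 x ∧ nm.2 ∈ quadWindow δ x) ∧
      ((∀ j, 0 < (f j).eval (nm.1 : ℤ) ∧
        ∀ p ∈ range ⌈(x : ℝ) ^ c⌉₊, p.Prime → ¬ ((p : ℤ) ∣ (f j).eval (nm.1 : ℤ))) ∧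
      ((nm.2 : ℤ) ∣ (f i).eval (nm.1 : ℤ)) ∧
      nm.2.Coprime
        (2 * (f i).coeff 2 * discrim ((f i).coeff 2) ((f i).coeff 1) ((f i).coeff 0)).natAbs) := by
  unfold pairFamily
  rw [mem_filter, mem_product]

end Summit.Parity.BatemanHorn.Cruxes.BalancedSemiprimeLayer.SmoothModulusTwistedHooley

/-! ## Vocabulary of the line `rough-relaxed-divisor-sieve` (companion lead c1, 2026-08-16):
## the rough balanced-divisor window of a coordinate of ANY degree and its Type-I hypothesis

The degree-blind lever of the line (`stub_roughWindowLever`, skeleton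
`Cruxes/BalancedSemiprimeLayer/Lines/rough_relaxed_divisor_sieve_c1.lean`) sifts the weighted line
`n ↦ #{m ∈ roughDivWindow dᵢ δ c x : m ∣ fᵢ(n)}` (`1 ≤ n ≤ x`, `dᵢ = deg fᵢ`) by the primes `p < x^c`
dividing `F(n) = ∏ⱼ fⱼ(n)` — a `k`-dimensional upper-bound sieve whose ONLY non-tree input is the
Type-I hypothesis `RoughWindowTypeI f i` below (level `x^c` for the pair counts, the window variable
summed INSIDE the absolute value).  For `dᵢ ≤ 2` the hypothesis is provable (and that case of the crux is
closed by the line `smooth-modulus-twisted-hooley`); for `dᵢ ≥ 3` its moduli `m ≥ x^{dᵢ(1−δ)/2} > x`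
exceed the number of terms and it is the crux's open core in pure Type-I form (no primality, no sieve).
Everything here is a plain `Finset.filter` count or a `Prop` over `polyRootCountMod`, `Polynomial.eval`;
nothing is asserted.  Reference: the line card `Cruxes/BalancedSemiprimeLayer/Lines/rough-relaxed-divisor-sieve.md`
(lever S1 "relax both primes, sieve the divisor-weighted line"); C. Hooley, Acta Math. 117 (1967) 281–299, §3
(the divisor-switched sieve this imitates). -/

namespace Summit.Parity.BatemanHorn.Cruxes.BalancedSemiprimeLayer.RoughRelaxedDivisorSieve

/-- The **balanced-divisor window** of a coordinate of degree `d` at height `x`: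
`divWindow d δ x = ℕ ∩ [x^{d(1−δ)/2}, x^{d(1+δ)/2}]` (logarithmic length `dδ·log x`).  The least prime
factor of a non-prime value `fᵢ(n) ≠ 1` of a jointly `δ`-rough `n ≤ x` lies in it eventually
(`p₁ ≥ x^{d(1−δ)/2}` by roughness, `p₁² ≤ fᵢ(n) ≪ x^d`).  For `d = 2` this is `quadWindow δ x`. [folklore] -/
def divWindow (d : ℕ) (δ : ℝ) (x : ℕ) : Finset ℕ :=
  Icc ⌈(x : ℝ) ^ ((d : ℝ) * (1 - δ) / 2)⌉₊ ⌊(x : ℝ) ^ ((d : ℝ) * (1 + δ) / 2)⌋₊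

/-- The **rough squarefree moduli of the window**: `m ∈ divWindow d δ x`, `m` squarefree, every prime
factor of `m` exceeds `x^c` (real, strict; stated over `Nat.primeFactors m`).  Roughness makes `m`
coprime to every sieve modulus `e ∣ P(x^c)`, so the pair counts below have the EXACT CRT main term
`x·ρᵢ(m)/m·ρ_F(e)/e`. [folklore] -/
def roughDivWindow (d : ℕ) (δ c : ℝ) (x : ℕ) : Finset ℕ :=
  (divWindow d δ x).filter (fun m : ℕ => Squarefree m ∧ ∀ p ∈ m.primeFactors, (x : ℝ) ^ c < (p : ℝ))

/-- Membership in `roughDivWindow` (unfolding; the roughness clause in the form "every prime divisor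
of `m` exceeds `x^c`"). [folklore] -/
theorem mem_roughDivWindow {d : ℕ} {δ c : ℝ} {x m : ℕ} :
    m ∈ roughDivWindow d δ c x ↔
      m ∈ divWindow d δ x ∧ Squarefree m ∧ ∀ p : ℕ, p.Prime → p ∣ m → (x : ℝ) ^ c < (p : ℝ) := by
  unfold roughDivWindow
  rw [mem_filter]
  refine and_congr_right fun _ => and_congr_right fun hsq => ?_
  constructor
  · intro h p hp hpm
    exact h p (Nat.mem_primeFactors.mpr ⟨hp, hpm, hsq.ne_zero⟩)
  · intro h p hp
    obtain ⟨hpp, hpm, -⟩ := Nat.mem_primeFactors.mp hp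
    exact h p hpp hpm

/-- The **positive range** of the system at height `x`: the `1 ≤ n ≤ x` at which EVERY `fⱼ(n) > 0`
(all `n ≥ n₀(f)`, since the leading coefficients are positive; the crux's own predicate carries the
same clause).  On it `F(n) = ∏ⱼ fⱼ(n) > 0`, so the pairs can be booked at the value `F(n)`. [folklore] -/
def posRange {k : ℕ} (f : Fin k → ℤ[X]) (x : ℕ) : Finset ℕ :=
  (Icc 1 x).filter (fun n : ℕ => ∀ j, 0 < (f j).eval (n : ℤ))

/-- Membership in `posRange` (unfolding). [folklore] -/
theorem mem_posRange {k : ℕ} {f : Fin k → ℤ[X]} {x n : ℕ} :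
    n ∈ posRange f x ↔ n ∈ Icc 1 x ∧ ∀ j, 0 < (f j).eval (n : ℤ) := by
  unfold posRange
  rw [mem_filter]

/-- The **pair count** `P(x; m, e) = #{n ∈ posRange f x : m ∣ fᵢ(n), e ∣ ∏ⱼ fⱼ(n)}` — the congruence
sums of the weighted line `n ↦ #{m : m ∣ fᵢ(n)}` sifted by the primes dividing `F(n) = ∏ⱼ fⱼ(n)`. [folklore] -/
def windowPairCount {k : ℕ} (f : Fin k → ℤ[X]) (i : Fin k) (x m e : ℕ) : ℕ :=
  #((posRange f x).filter (fun n : ℕ =>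
      ((m : ℤ) ∣ (f i).eval (n : ℤ)) ∧ ((e : ℤ) ∣ ∏ j, (f j).eval (n : ℤ))))

/-- The **signed remainder** of the pair count against its CRT main term:
`r(x; m, e) = P(x; m, e) − x·(ρᵢ(m)/m)·(ρ_F(e)/e)` with `ρᵢ = polyRootCountMod ![fᵢ]` and
`ρ_F = polyRootCountMod f` (root count of the product).  The main term is the exact density for
`(m, e) = 1`, which is the only case the lever uses (`m` rough, `e ∣ P(x^c)`). [folklore] -/
def windowPairRem {k : ℕ} (f : Fin k → ℤ[X]) (i : Fin k) (x m e : ℕ) : ℝ :=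
  (windowPairCount f i x m e : ℝ) -
    (x : ℝ) * ((polyRootCountMod ![f i] m : ℝ) / m) * ((polyRootCountMod f e : ℝ) / e)

/-- **`RoughWindowTypeI f i`** — Type-I information, at level `x^c`, for the rough balanced-divisor
line of coordinate `i`, WITH CANCELLATION OVER THE WINDOW VARIABLE: there is `c₀ > 0` such that for
all `0 < c ≤ c₀` and `0 < δ ≤ c` there is `η > 0` with, eventually in `x`,
`∑_{e ≤ x^c, e squarefree} |∑_{m ∈ roughDivWindow dᵢ δ c x} r(x; m, e)| ≤ x^{1−η}`.
(The trivial bound is `x^{dᵢ(1+δ)/2 + c + o(1)}`; the hypothesis asks for the equidistribution of the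
roots of `fᵢ mod m` in the initial segment `posRange f x ⊆ [1, x]` of one period, on average over the rough squarefree
`m` of the window, twisted by `e ∣ F(n)`, `e ≤ x^c`.)  Degree `1`: `m ≤ x^{(1+δ)/2} < x` and every
remainder is `O(ρᵢ(m)ρ_F(e))` — provable.  Degree `2`: the moduli straddle `x`; supplied (in the
`(k+1)`-dimensional packaging) by the landed twisted-Hooley/uniform-Type-I files of the line
`smooth-modulus-twisted-hooley`.  Degree `≥ 3`: `m ≥ x^{dᵢ(1−δ)/2} ≥ x^{9/8} > x` — root equidistribution
BEYOND the number of terms with power saving uniform in frequencies `≤ m/x`; not in print (Hooley 1964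
gives `(log m)^{−c_d}` at fixed frequency); this is the open core of the crux `BalancedSemiprimeLayer`
for coordinates of degree `≥ 3`, isolated from all sieve and primality bookkeeping by
`stub_roughWindowLever`.  Monotone in `c₀` by design (smaller `c₀` only removes obligations). [folklore] -/
def RoughWindowTypeI {k : ℕ} (f : Fin k → ℤ[X]) (i : Fin k) : Prop :=
  ∃ c₀ : ℝ, 0 < c₀ ∧ ∀ c : ℝ, 0 < c → c ≤ c₀ → ∀ δ : ℝ, 0 < δ → δ ≤ c →
    ∃ η : ℝ, 0 < η ∧ ∀ᶠ x : ℕ in atTop,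
      (∑ e ∈ (Icc 1 ⌊(x : ℝ) ^ c⌋₊).filter Squarefree,
          |∑ m ∈ roughDivWindow (f i).natDegree δ c x, windowPairRem f i x m e|) ≤ (x : ℝ) ^ (1 - η)

/-- **stub_memRoughDivWindow** (the registered bookkeeping stub of the skeleton
`Cruxes/BalancedSemiprimeLayer/Lines/rough_relaxed_divisor_sieve_c1.lean`, through which this
vocabulary section lands as a `--supports` file): membership in the rough window, with the roughness
clause read as "every prime divisor of `m` exceeds `x^c`". [folklore] -/
theorem stub_memRoughDivWindow :
    ∀ (d : ℕ) (δ c : ℝ) (x m : ℕ), m ∈ roughDivWindow d δ c x ↔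
      m ∈ divWindow d δ x ∧ Squarefree m ∧ ∀ p : ℕ, p.Prime → p ∣ m → (x : ℝ) ^ c < (p : ℝ) :=
  fun _ _ _ _ _ => mem_roughDivWindow

end Summit.Parity.BatemanHorn.Cruxes.BalancedSemiprimeLayer.RoughRelaxedDivisorSieve
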